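import Summits.CriticalPhenomena.CardyFormulaZ2.Theorems.CardyFlipRussoVoronoiHubFromSmirnovStubMeckeRusso
import Summits.CriticalPhenomena.CardyFormulaZ2.Theorems.CardyFlipRussoVoronoiHubFromSmirnovStubMeasurableCrossEventReduction
import Summits.CriticalPhenomena.CardyFormulaZ2.Theorems.CardyFlipRussoVoronoiHubFromSmirnovStubPeanoPathConnected
import Summits.CriticalPhenomena.CardyFormulaZ2.Theorems.CardyFlipRussoVoronoiHubFromSmirnovStubComponentsCIK
import Literature.Analysis.FunctionSpaces.PoissonPointProcessUniqueness

/-!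
# Crux `VoronoiHubFromSmirnov` (stmt-CriticalPhenomena-6433): what line `moebius-exact-delaunay-dilation-ward` proved, and the reduction that remains

Route `CardyFlipRusso`, sub-problem `CardyFormulaZ2`; lead `prover-line-stmt-CriticalPhenomena-6433-a1-0`,
2026-08-16.  The crux is (equivalent to) Cardy's formula for annealed Poisson–Voronoi percolation
(Benjamini–Schramm 1998 conjecture).  This file assembles the sorry-free output of the line:

* `stub_measurableCrossEvent : Sig.stub_measurableCrossEvent` — **the continuum Voronoi crossing event of
  every conformal rectangle at every mesh is MEASURABLE** in the product of the count σ-algebras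
  (UNCONDITIONAL; the planner's stub S0): hitting events / continuum sandwich / reduction to plane
  topology (p123093, p123286, p123575, p123590) + Moore–Mazurkiewicz (`stub_peanoPathConnected`, p124951)
  + components of a closed Jordan disc cut by convex bodies are connected im kleinen
  (`stub_componentsCIK`, p124842), glued by `joinedInConvexPieces`;
* the Mecke–Russo identity S1 is `stub_meckeRusso` (p123634, imported);
* `dilationWard_of_wardBound`, `densityBlind_of_wardBound`, `conformalNull_of` — the glue from the
  KERNEL `Sig.stub_wardBound` (Benjamini–Schramm's Density-Invariance Conjecture 10.1 in differential
  form — OPEN) and the transport statement `Sig.stub_conformalTransport` (BS98 Thm 2.1 re-cut for Jordan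
  conformal rectangles — not in the tree) to density blindness and asymptotic conformal invariance;
* `VoronoiHubFromSmirnov_of_line : Sig.stub_wardBound → Sig.stub_conformalTransport →
  Sig.stub_identification → VoronoiHubFromSmirnov` — the crux REDUCED to three named statements
  (a CONDITIONAL result: S2′ open conjecture, S3 and S4 research-level literature debts; see the skeleton
  `Cruxes/VoronoiHubFromSmirnov/Lines/moebius_exact_delaunay_dilation_ward.lean` and the line card).

No new definitions; nothing is asserted beyond what is proved.
-/

noncomputable section

namespace Summit.CriticalPhenomena.CardyFormulaZ2.Cruxes.VoronoiHubFromSmirnov.MoebiusExactDelaunayDilationWard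

open scoped Topology ENNReal Interval
open Filter Set MeasureTheory
open Literature.Analysis.FunctionSpaces
open Literature.Probability.RandomPlanarGeometry

/-! ### S0: measurability of the crossing event (unconditional) -/

/-- S0′a + S0′b ⇒ S0′: inside the compact set `K = closure Ω ∩ ⋃₀ 𝒞` a preconnected `S` lies in
one component `M` (closed, hence compact, preconnected); `M` is connected im kleinen everywhere
(S0′b), hence path connected (S0′a), and paths in `M` are paths in `K`. -/
theorem joinedInConvexPieces_of (hP : Sig.stub_peanoPathConnected) (hC : Sig.stub_componentsCIK) :
    Sig.stub_joinedInConvexPieces := by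
  intro Ω 𝒞 h𝒞 hconv S hSK hS x hx y hy
  set K : Set ℂ := closure Ω.carrier ∩ ⋃₀ 𝒞 with hK
  have hUcl : IsClosed (⋃₀ 𝒞) := by
    rw [Set.sUnion_eq_biUnion]
    exact h𝒞.isClosed_biUnion fun C hC' => (hconv C hC').1
  have hKcl : IsClosed K := isClosed_closure.inter hUcl
  have hKc : IsCompact K := Ω.isBounded.isCompact_closure.inter_right hUcl
  have hxK : x ∈ K := hSK hx
  set M : Set ℂ := connectedComponentIn K x with hM
  have hSM : S ⊆ M := hS.subset_connectedComponentIn hx hSK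
  have hMK : M ⊆ K := connectedComponentIn_subset K x
  have hMcl : IsClosed M := by
    refine isClosed_of_closure_subset ?_
    exact isPreconnected_connectedComponentIn.closure.subset_connectedComponentIn
      (subset_closure (mem_connectedComponentIn hxK)) (closure_minimal hMK hKcl)
  have hMc : IsCompact M := hKc.of_isClosed_subset hMcl hMK
  have hj : JoinedIn M x y :=
    hP M hMc isPreconnected_connectedComponentIn (fun z hz => hC Ω 𝒞 h𝒞 hconv x hxK z hz) x
      (mem_connectedComponentIn hxK) y (hSM hy)
  exact hj.mono hMK

/-- S0′ ⇒ S0: measurability of the crossing event from path-connectedness of the pieces (the landed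
reduction, p123590). -/
theorem measurableCrossEvent_of (h : Sig.stub_joinedInConvexPieces) : Sig.stub_measurableCrossEvent :=
  stub_measurableCrossEvent_of_joinedIn_convexPieces h


/-- **Components of a closed Jordan disc cut by finitely many convex bodies are path connected**
(unconditional: `joinedInConvexPieces_of` with the landed `stub_peanoPathConnected`, p124951, and
`stub_componentsCIK`, p124842). -/
theorem joinedInConvexPieces : Sig.stub_joinedInConvexPieces :=
  joinedInConvexPieces_of stub_peanoPathConnected stub_componentsCIK

/-- **S0, the planner's stub, UNCONDITIONALLY: the crux's continuum crossing event `crossEvent R δ` is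
measurable for every conformal rectangle `R` and every mesh `δ > 0`.** -/
theorem stub_measurableCrossEvent : Sig.stub_measurableCrossEvent :=
  measurableCrossEvent_of joinedInConvexPieces

/-! ### Glue from the kernel S2′ and the transport S3 -/

/-- S2′ ⇒ S2: the Ward bound plus the landed integrability of the weighted insertion response
(`integrable_weight_mul_insResp`, p122876) give the dilation Ward identity as stated. -/
theorem dilationWard_of_wardBound (hW : Sig.stub_wardBound) : Sig.stub_dilationWard := by
  intro ρ hρ w hw R hS ε hε
  filter_upwards [hW ρ hρ w hw R hS ε hε, self_mem_nhdsWithin] with δ hδ hδpos t ht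
  exact ⟨integrable_weight_mul_insResp ρ hρ w hw.1.continuous hw.2 R δ hδpos (hS δ hδpos) t ht,
    hδ t ht⟩

/-- The weight `ρ − 1` of an admissible profile is a test weight. -/
theorem testWeight_sub_one {ρ : ℂ → ℝ} (hρ : AdmissibleDensity ρ) : TestWeight fun x => ρ x - 1 :=
  ⟨hρ.1.sub contDiff_const, hρ.2.1⟩

/-- **Mecke + Ward ⇒ density blindness**: `P_ρ − P_1 = ∫₀¹ (∫ (ρ(δz) − 1) insResp_t dz) dt` and the
inner integral is eventually `≤ ε` uniformly in `t ∈ [0,1]`. -/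
theorem densityBlind_of (hS : Sig.stub_measurableCrossEvent) (hM : Sig.stub_meckeRusso)
    (hW : Sig.stub_dilationWard) : DensityBlind := by
  intro ρ hρ R
  rw [Metric.tendsto_nhds]
  intro ε hε
  have hev := hW ρ hρ (fun x => ρ x - 1) (testWeight_sub_one hρ) R (fun δ hδ => hS R δ hδ) (ε / 2)
    (half_pos hε)
  filter_upwards [hev, self_mem_nhdsWithin] with δ hδW hδpos
  rw [Real.dist_0_eq_abs, (hM ρ hρ R δ hδpos (hS R δ hδpos)).2]
  have hb : ∀ t ∈ Ι (0:ℝ) 1, ‖∫ z, (ρ ((δ : ℂ) * z) - 1) * insResp ρ t R δ z‖ ≤ ε / 2 := by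
    intro t ht
    rw [Set.uIoc_of_le zero_le_one] at ht
    rw [Real.norm_eq_abs]
    exact (hδW t ⟨ht.1.le, ht.2⟩).2
  have hI := intervalIntegral.norm_integral_le_of_norm_le_const hb
  rw [Real.norm_eq_abs] at hI
  calc |∫ t in (0:ℝ)..1, ∫ z, (ρ ((δ : ℂ) * z) - 1) * insResp ρ t R δ z|
      ≤ ε / 2 * |1 - 0| := hI
    _ < ε := by norm_num; linarith


/-- **Kernel ⇒ density blindness**, unconditionally in everything but the kernel: the Ward bound S2′
implies Benjamini–Schramm density invariance for admissible profiles (S0 and S1 are theorems). -/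
theorem densityBlind_of_wardBound (hW : Sig.stub_wardBound) : DensityBlind :=
  densityBlind_of stub_measurableCrossEvent stub_meckeRusso (dilationWard_of_wardBound hW)

/-- **Density blindness + conformal transport ⇒ asymptotic conformal invariance.** -/
theorem conformalNull_of (hD : DensityBlind) (hT : Sig.stub_conformalTransport) : ConformalNull := by
  intro R h U hU hRU hd hi
  obtain ⟨ρ, hρ, -, hlim⟩ := hT R h U hU hRU hd hi
  have h2 := hlim.add (hD ρ hρ R)
  rw [add_zero] at h2
  refine h2.congr' (Eventually.of_forall fun δ => ?_)
  rw [crossProb_zero]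
  ring

/-- The chosen law `poissonLaw volume` IS a Poisson process of Lebesgue intensity as soon as one
exists (in the composition the crux's own `PB` is the witness; unconditionally by
`existsUnique_isPoissonPointProcess_holds`). -/
theorem isPoissonPointProcess_poissonLaw {P : Measure (PointConfig ℂ)}
    (hP : IsPoissonPointProcess volume P) : IsPoissonPointProcess volume (poissonLaw volume) :=
  Classical.epsilon_spec (p := fun Q : Measure (PointConfig ℂ) => IsPoissonPointProcess volume Q)
    ⟨P, hP⟩

/-- Crossing probabilities are probabilities. -/
theorem homCrossProb_mem_Icc (hP : IsPoissonPointProcess volume (poissonLaw volume))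
    (R : ConformalRectangle) (δ : ℝ) : homCrossProb R δ ∈ Icc (0:ℝ) 1 := by
  haveI := hP.isProbabilityMeasure
  haveI : IsProbabilityMeasure (lawBW (volume : Measure ℂ)) := by
    unfold lawBW; infer_instance
  exact ⟨measureReal_nonneg, measureReal_le_one⟩

/-! ### The reduction of the crux -/

/-- **The line.** The three open stubs S2′ (Ward bound ⇒ dilation Ward identity, via the landed
integrability), S3 (conformal transport) and S4 (identification), together with the PROVED
Mecke–Russo identity S1 (`stub_meckeRusso`, p123634), imply `VoronoiHubFromSmirnov` (real proof:
Rényi uniqueness rewrites the crux's `PB`, `PW` as `poissonLaw volume`; `densityBlind_of`,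
`conformalNull_of`; sequential compactness of `[0,1]` and `Filter.tendsto_of_subseq_tendsto` turn the
identification of sequential cluster values into the limit.  The antecedent — Smirnov's theorem,
proved in tree — is not used). -/
theorem VoronoiHubFromSmirnov_of_line :
    Sig.stub_wardBound → Sig.stub_conformalTransport → Sig.stub_identification →
      Summit.CriticalPhenomena.CardyFormulaZ2.Theses.CardyFlipRusso.VoronoiHubFromSmirnov := by
  intro hWB hT hI _hSmirnov PB PW hB hW' R φ x hφx
  have hS : Sig.stub_measurableCrossEvent :=
    stub_measurableCrossEvent
  have hW : Sig.stub_dilationWard := dilationWard_of_wardBound hWB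
  have hCN : ConformalNull := conformalNull_of (densityBlind_of hS stub_meckeRusso hW) hT
  have hP : IsPoissonPointProcess volume (poissonLaw volume) := isPoissonPointProcess_poissonLaw hB
  obtain rfl : PB = poissonLaw volume := IsPoissonPointProcess.unique_holds hB hP
  obtain rfl : PW = poissonLaw volume := IsPoissonPointProcess.unique_holds hW' hP
  change Tendsto (fun δ => homCrossProb R δ) (𝓝[>] 0) (𝓝 (cardyFunction (crossRatio x)))
  refine tendsto_of_subseq_tendsto fun s hs => ?_
  obtain ⟨L, -, ms, hms, hlim⟩ := isCompact_Icc.tendsto_subseq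
    (x := fun n => homCrossProb R (s n)) fun n => homCrossProb_mem_Icc hP R (s n)
  refine ⟨ms, ?_⟩
  have hs' : Tendsto (s ∘ ms) atTop (𝓝[>] 0) := hs.comp hms.tendsto_atTop
  have hlim' : Tendsto (fun n => homCrossProb R ((s ∘ ms) n)) atTop (𝓝 L) := hlim
  have hL : L = cardyFunction (crossRatio x) := hI hCN R φ x hφx (s ∘ ms) L hs' hlim'
  rw [← hL]
  exact hlim'


/-! ### The reduction on the standard named debts (continuation lead c1, 2026-08-16)

The kernel S2′ (`Sig.stub_wardBound`, the Ward / differential form) is this line's proposed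
MECHANISM for Benjamini–Schramm density invariance; it is slightly STRONGER than what the
composition consumes (it asks for a bound uniform in the path parameter `t`, while
`conformalNull_of` only uses `DensityBlind`).  The two theorems below restate the landed reduction
on the two standard statements, so that the crux can be carried as a conditional result on
Benjamini–Schramm's Density-Invariance Conjecture 10.1 itself (weak "difference" form for smooth
positive profiles equal to `1` off a compact set = `DensityBlind`, Defs module) — respectively on
asymptotic conformal invariance `ConformalNull` (BS98 Conj. 10.2 without existence of limits, for
maps univalent near `closure Ω`) — rather than on the line's sharper Ward form.  Pure glue over
`conformalNull_of` and the proof of `VoronoiHubFromSmirnov_of_line`; nothing new is asserted. -/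

/-- **Asymptotic conformal invariance + identification ⇒ the crux.**  If the homogeneous annealed
crossing probabilities are asymptotically conformally invariant (`ConformalNull`) and conformally
invariant subsequential limits are Cardy's (`Sig.stub_identification`, S4), then
`VoronoiHubFromSmirnov` holds (Rényi uniqueness identifies the crux's `PB`, `PW` with
`poissonLaw volume`; sequential compactness of `[0,1]` and `Filter.tendsto_of_subseq_tendsto` turn
"every sequential cluster value is Cardy's" into the crossing limit; Smirnov's antecedent unused). -/
theorem VoronoiHubFromSmirnov_of_conformalNull :
    ConformalNull → Sig.stub_identification →
      Summit.CriticalPhenomena.CardyFormulaZ2.Theses.CardyFlipRusso.VoronoiHubFromSmirnov := by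
  intro hCN hI _hSmirnov PB PW hB hW' R φ x hφx
  have hP : IsPoissonPointProcess volume (poissonLaw volume) := isPoissonPointProcess_poissonLaw hB
  obtain rfl : PB = poissonLaw volume := IsPoissonPointProcess.unique_holds hB hP
  obtain rfl : PW = poissonLaw volume := IsPoissonPointProcess.unique_holds hW' hP
  change Tendsto (fun δ => homCrossProb R δ) (𝓝[>] 0) (𝓝 (cardyFunction (crossRatio x)))
  refine tendsto_of_subseq_tendsto fun s hs => ?_
  obtain ⟨L, -, ms, hms, hlim⟩ := isCompact_Icc.tendsto_subseq
    (x := fun n => homCrossProb R (s n)) fun n => homCrossProb_mem_Icc hP R (s n)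
  refine ⟨ms, ?_⟩
  have hs' : Tendsto (s ∘ ms) atTop (𝓝[>] 0) := hs.comp hms.tendsto_atTop
  have hlim' : Tendsto (fun n => homCrossProb R ((s ∘ ms) n)) atTop (𝓝 L) := hlim
  have hL : L = cardyFunction (crossRatio x) := hI hCN R φ x hφx (s ∘ ms) L hs' hlim'
  rw [← hL]
  exact hlim'

/-- **Density invariance + conformal transport + identification ⇒ the crux.**  The crux
`VoronoiHubFromSmirnov` follows from Benjamini–Schramm's Density-Invariance Conjecture in the weak
(difference) form for admissible profiles (`DensityBlind`), the conformal transport S3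
(`Sig.stub_conformalTransport`, BS98 Thm 2.1 re-cut for Jordan conformal rectangles) and the
identification S4 (`Sig.stub_identification`) — via `conformalNull_of` and
`VoronoiHubFromSmirnov_of_conformalNull`.  This is the line's reduction stated on the standard
conjecture rather than on its Ward form S2′ (which implies `DensityBlind`:
`densityBlind_of_wardBound`). -/
theorem VoronoiHubFromSmirnov_of_densityBlind :
    DensityBlind → Sig.stub_conformalTransport → Sig.stub_identification →
      Summit.CriticalPhenomena.CardyFormulaZ2.Theses.CardyFlipRusso.VoronoiHubFromSmirnov :=
  fun hD hT hI => VoronoiHubFromSmirnov_of_conformalNull (conformalNull_of hD hT) hI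

end Summit.CriticalPhenomena.CardyFormulaZ2.Cruxes.VoronoiHubFromSmirnov.MoebiusExactDelaunayDilationWard

end
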